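import Summits.QuantumFields.YangMills.Theorems.BalabanUVNodesN20KnitThreshold
import Literature.MathematicalPhysics.QuantumFieldTheory.Balaban1983to89.T4MatchingClosureRem

/-!
# BalabanUVNodes ∕ N20 knit, LOG-CUT threshold form — node N20 = NE7b (`T4WeightBudget.RelWeightBound`) at exact carriers for every origin beyond a
# numeric threshold when the bad class is pinned at the LOGARITHMIC window `T4GoodClassBudget.jlogOf C` (cluster K5's SREC5 design, interface I-3)

HONEST FRAMING.  Count-neutral kernel bookkeeping BY NAME, companion of `BalabanUVNodesN20Knit` (p409854) ∕ `…N20KnitDerived` (p410322) ∕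
`…N20KnitThreshold` (p411645) of this seat's lineage (Track A, DAG node N20; cluster K5 «SpineMatching»).  NE7b is the cell `pub-balaban`'s OWN estimate —
NOT PRINTED in [Bałaban 1983–89], NOT PROVED; (α)-instance 0∕1, «NC-NE7b-α» UNRULED; no NODE 00 stage pins N20's carriers; nothing here is a node
discharge.  One finite four-torus programme at fixed ε; nothing continuum ∕ ℝ⁴ ∕ OS ∕ mass-gap ∕ Clay.  0 `sorry`, 0 `def`, standard axioms.

WHY.  The tower records of the re-cut (α) road cut the bad class at `T4RenewalChains.jhalf` (`N20KnitThreshold` §§2–3).  dag-n27-a's design datum for the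
K5 record predicate SREC5 (INBOX l.9220 (C)(iii)) pins instead «`Bad K t` = the classes with an OLD pending large-field structure, creation scale
`< j⋆(K) = T4GoodClassBudget.jlogOf C K`, log cut — interface I-3: ONE criterion for both runs» (`T4GoodClassBudget` §3b: with the LOG window the weight
majorant `V·r^{K − jlog K}` is summable as soon as `C·(−log r) > 1`, `summable_weightMajorant_log`, and ONE cut serves both budgets).  The
carrier-abstract knit `N20Knit.relWeightBound_of_extractionLaws` is cut-agnostic; this file supplies the log cut's threshold conveniences letter for letter
those of `N20KnitThreshold` §1, so that `S_N20` at a log-cut SREC5 is again ONE application: the window length `K − jlog K = min(K, ⌈C·log(K+1)⌉)` is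
monotone (`sub_jlogOf_mono`), the majorant antitone (`weightMajorant_log_antitone`), the side condition `V·r^{K₁ − jlog K₁} < 1` upward-closed
(`threshold_log_mono`; `0 ≤ C` from `C·(−log r) > 1` is the tree's `T4MatchingClosureRem.logCutConst_nonneg`), implied by `log V < min(K₁, C·log(K₁+1))·log r⁻¹` (`threshold_log_of_log`) and met from some origin on (`exists_threshold_log`);
**`relWeightBound_of_extractionLaws_threshold_log`**: two runs' `PinnedExtraction.ExtractionLaws` + the count in log-cut currency from `K₁` on + the side
condition at `K₁` ⇒ `RelWeightBound` at the `K₁`-shifted EXACT carriers with weight `V·r^{(K₁+K) − jlog(K₁+K)}` VERBATIM; `exists_…` the `∃`-form.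

WHAT HAS NO TREE PRODUCER (unchanged): an inhabitant of the extraction laws ∕ «LCS-j» for Bałaban's tower at either cut ((A1c); owner WALL
`ROW-NE7b-STATE.md` v1.76 §3), and the count in log-cut currency for it (the cell's banking arithmetic is typed at `jhalf` ∕ linear cuts:
`T4WeightBudget.summable_weightMajorant`, `T4GoodClassBudget.summable_weightMajorant_of_cut`; at the log cut only the summability of the majorant and the
polynomial window count `windowCount_log_le` ∕ `summable_polyRate_logWindow` are in the tree).

Sources: T. Bałaban, CMP **122** (1989) 175–202 [Balaban1989LargeFieldI] p. 175, p. 177 (i)∕(ii); CMP **122** (1989) 355–392 [Balaban1989LargeFieldII]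
(1.79)–(1.89) pp. 383–387, (2.46) p. 263 of [Balaban1987RG1] for the free perturbation order behind the log window's polynomial rate; C. King, CMP **102**
(1986) [King1986] (3.10)–(3.11) p. 656 (printed MODEL).  Nothing here is a claim about the Yang–Mills mass gap.
-/

open Finset MeasureTheory
open Literature.MathematicalPhysics.QuantumFieldTheory.Balaban1983to89 T4WeightBudget T4RenewalChains
open Summit.QuantumFields.BalabanUV.T4Continuum.NE7b.PinnedExtraction
open Summit.QuantumFields.YangMills.BalabanUVNodes.N20KnitThreshold (relWeightBound_shift_at)

noncomputable section

namespace Summit.QuantumFields.YangMills.BalabanUVNodes.N20KnitLogCut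

/-! ## §1 THE LOG-CUT TWIN of `N20KnitThreshold` §1 — for a record predicate that pins the bad class at the logarithmic window
`T4GoodClassBudget.jlogOf C` («creation scale `< jlog(K) = K − ⌈C·log(K+1)⌉`», interface I-3 of dag-n27-a's SREC5 design (C)(iii), INBOX l.9220)

The tower records of the re-cut (α) road cut at `jhalf` (§§2–3); cluster K5's record predicate may instead pin the LOG cut of
`T4GoodClassBudget` §3b (ONE cut for both budgets, weight majorant summable by `summable_weightMajorant_log` once `C·(−log r) > 1`).  The
carrier-abstract knit `N20Knit.relWeightBound_of_extractionLaws` is cut-agnostic; here are the log cut's threshold conveniences, letter for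
letter the §1 ones: the exponent `K − jlog(K) = min(K, ⌈C·log(K+1)⌉)` is monotone in `K` (`0 ≤ C`), so the side condition
`V·r^{K₁ − jlog K₁} < 1` at an origin is the condition at every later cutoff, it holds from some origin on, and two runs' extraction laws + the
count in log-cut currency from `K₁` on give `RelWeightBound` at the `K₁`-shifted exact carriers. [folklore arithmetic] -/

section LogCut

open T4GoodClassBudget (jlogOf min_le_sub_jlogOf summable_weightMajorant_log)

variable {ι α α' : Type*} {l₀ : ℝ} {T : ℕ → Finset ι} {A B : ℕ → ℝ → ι → ℝ} {Bad Bad' : ℕ → ℝ → Finset ι}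
  {X : ℕ → Finset α} {Badx : ℕ → α → Finset ι} {q : ℕ → α → ℝ}
  {X' : ℕ → Finset α'} {Badx' : ℕ → α' → Finset ι} {q' : ℕ → α' → ℝ}

/-- The log window's length `K − jlog(K) = min(K, ⌈C·log(K+1)⌉)` is monotone in the cutoff (`0 ≤ C`). [folklore] -/
theorem sub_jlogOf_mono {C : ℝ} (hC : 0 ≤ C) {K K' : ℕ} (h : K ≤ K') : K - jlogOf C K ≤ K' - jlogOf C K' := by
  have hlog : C * Real.log ((K : ℝ) + 1) ≤ C * Real.log ((K' : ℝ) + 1) :=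
    mul_le_mul_of_nonneg_left (Real.log_le_log (by positivity) (by exact_mod_cast Nat.add_le_add_right h 1)) hC
  have hceil : ⌈C * Real.log ((K : ℝ) + 1)⌉₊ ≤ ⌈C * Real.log ((K' : ℝ) + 1)⌉₊ := Nat.ceil_mono hlog
  unfold jlogOf
  omega

/-- **THE LOG-CUT MAJORANT IS ANTITONE**: `V·r^{K′ − jlog K′} ≤ V·r^{K − jlog K}` for `K ≤ K′` (`0 ≤ r ≤ 1`, `0 ≤ V`, `0 ≤ C`). [folklore] -/
theorem weightMajorant_log_antitone {r V C : ℝ} (h0 : 0 ≤ r) (h1 : r ≤ 1) (hV : 0 ≤ V) (hC : 0 ≤ C) {K K' : ℕ} (h : K ≤ K') :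
    V * r ^ (K' - jlogOf C K') ≤ V * r ^ (K - jlogOf C K) :=
  mul_le_mul_of_nonneg_left (pow_le_pow_of_le_one h0 h1 (sub_jlogOf_mono hC h)) hV

/-- **UPWARD CLOSURE of the log-cut side condition.** [folklore] -/
theorem threshold_log_mono {r V C : ℝ} (h0 : 0 ≤ r) (h1 : r ≤ 1) (hV : 0 ≤ V) (hC : 0 ≤ C) {K₁ K₁' : ℕ} (h : K₁ ≤ K₁')
    (hthr : V * r ^ (K₁ - jlogOf C K₁) < 1) : V * r ^ (K₁' - jlogOf C K₁') < 1 :=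
  (weightMajorant_log_antitone h0 h1 hV hC h).trans_lt hthr

/-- **THE LOG-CUT SIDE CONDITION FROM A LOGARITHMIC INEQUALITY**: `log V < min(K₁, C·log(K₁+1))·log r⁻¹` (`0 < r < 1`, `0 ≤ V`) gives
`V·r^{K₁ − jlog K₁} < 1` (`T4GoodClassBudget.min_le_sub_jlogOf`). [folklore] -/
theorem threshold_log_of_log {r V C : ℝ} (h0 : 0 < r) (hr1 : r < 1) (hV : 0 ≤ V) {K₁ : ℕ}
    (hK : Real.log V < min (K₁ : ℝ) (C * Real.log ((K₁ : ℝ) + 1)) * Real.log r⁻¹) : V * r ^ (K₁ - jlogOf C K₁) < 1 := by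
  rcases hV.eq_or_lt with hV0 | hVpos
  · rw [← hV0, zero_mul]; exact one_pos
  have hle : r ^ (K₁ - jlogOf C K₁) ≤ r ^ (min (K₁ : ℝ) (C * Real.log ((K₁ : ℝ) + 1))) := by
    rw [← Real.rpow_natCast]
    exact Real.rpow_le_rpow_of_exponent_ge h0 hr1.le (min_le_sub_jlogOf C K₁)
  have hpos : 0 < V * r ^ (min (K₁ : ℝ) (C * Real.log ((K₁ : ℝ) + 1))) := mul_pos hVpos (Real.rpow_pos_of_pos h0 _)
  have hlog : Real.log (V * r ^ (min (K₁ : ℝ) (C * Real.log ((K₁ : ℝ) + 1)))) < 0 := by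
    rw [Real.log_mul hVpos.ne' (Real.rpow_pos_of_pos h0 _).ne', Real.log_rpow h0]
    have : Real.log r⁻¹ = -Real.log r := Real.log_inv r
    rw [this] at hK
    linarith
  exact (mul_le_mul_of_nonneg_left hle hV).trans_lt ((Real.log_neg_iff hpos).1 hlog)

/-- **NON-VACUITY of the log-cut side condition** (`0 < r < 1`, `0 ≤ V`, `C·(−log r) > 1`): it holds at some `K₁ ≥ K₀`
(`T4GoodClassBudget.summable_weightMajorant_log` ⇒ the majorant tends to `0`). [folklore] -/
theorem exists_threshold_log {r V C : ℝ} (h0 : 0 < r) (hr1 : r < 1) (hV : 0 ≤ V) (hC : 1 < C * (-Real.log r)) (K₀ : ℕ) :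
    ∃ K₁, K₀ ≤ K₁ ∧ V * r ^ (K₁ - jlogOf C K₁) < 1 := by
  obtain ⟨K₁, hK₁⟩ := Filter.eventually_atTop.mp
    (((summable_weightMajorant_log h0 hr1 hV hC).tendsto_atTop_zero).eventually (gt_mem_nhds one_pos))
  exact ⟨max K₀ K₁, le_max_left _ _, hK₁ _ (le_max_right _ _)⟩

/-- **N20 AT THE `K₁`-SHIFTED EXACT CARRIERS FOR EVERY ORIGIN BEYOND THE LOG-CUT THRESHOLD.**  Two runs' `PinnedExtraction.ExtractionLaws` over the
SAME term classes and bad classes `Bad′`, nonnegative weights, the count in LOG-CUT currency from `K₁` on (`Σ_x q K x ≤ V·r^{K − jlog K}`, both runs,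
`0 < r < 1`, `0 ≤ V`, `C·(−log r) > 1`), bad classes `Bad` agreeing with `Bad′` from `K₁` on, and `V·r^{K₁ − jlog K₁} < 1` give `RelWeightBound l₀` for
the `K₁`-shifted families with weight `V·r^{(K₁+K) − jlog (K₁+K)}` VERBATIM.  Proof as `relWeightBound_of_extractionLaws_threshold` with
`T4GoodClassBudget.summable_weightMajorant_log`. [folklore] -/
theorem relWeightBound_of_extractionLaws_threshold_log {r V C : ℝ} {K₁ : ℕ}
    (hA : ExtractionLaws l₀ T A Bad' X Badx q) (hB : ExtractionLaws l₀ T B Bad' X' Badx' q')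
    (hA0 : ∀ K t, |t| ≤ l₀ → ∀ τ, 0 ≤ A K t τ) (hB0 : ∀ K t, |t| ≤ l₀ → ∀ τ, 0 ≤ B K t τ)
    (h0 : 0 < r) (hr1 : r < 1) (hV : 0 ≤ V) (hC : 1 < C * (-Real.log r))
    (hmajA : ∀ K, K₁ ≤ K → ∑ x ∈ X K, q K x ≤ V * r ^ (K - jlogOf C K))
    (hmajB : ∀ K, K₁ ≤ K → ∑ x ∈ X' K, q' K x ≤ V * r ^ (K - jlogOf C K))
    (hBB : ∀ K t, K₁ ≤ K → Bad' K t = Bad K t) (hthr : V * r ^ (K₁ - jlogOf C K₁) < 1) :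
    RelWeightBound l₀ (fun K => T (K₁ + K)) (fun K => A (K₁ + K)) (fun K => B (K₁ + K)) (fun K => Bad (K₁ + K))
      fun K => V * r ^ (K₁ + K - jlogOf C (K₁ + K)) :=
  relWeightBound_shift_at
    (relWeightBound_of_extraction (W := fun K => V * r ^ (K - jlogOf C K)) hA hB hA0 hB0 hmajA hmajB
      (fun _ hK => threshold_log_mono h0.le hr1.le hV (T4MatchingClosureRem.logCutConst_nonneg h0 hr1 hC) hK hthr)
      (summable_weightMajorant_log h0 hr1 hV hC))
    hBB

/-- **… the `∃`-form**: under the log-cut count from `K₀` on, SOME origin `K₁ ≥ K₀` carries `RelWeightBound` at the shifted exact carriers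
(`exists_threshold_log`). [folklore] -/
theorem exists_relWeightBound_of_extractionLaws_threshold_log {r V C : ℝ} (K₀ : ℕ)
    (hA : ExtractionLaws l₀ T A Bad' X Badx q) (hB : ExtractionLaws l₀ T B Bad' X' Badx' q')
    (hA0 : ∀ K t, |t| ≤ l₀ → ∀ τ, 0 ≤ A K t τ) (hB0 : ∀ K t, |t| ≤ l₀ → ∀ τ, 0 ≤ B K t τ)
    (h0 : 0 < r) (hr1 : r < 1) (hV : 0 ≤ V) (hC : 1 < C * (-Real.log r))
    (hmajA : ∀ K, K₀ ≤ K → ∑ x ∈ X K, q K x ≤ V * r ^ (K - jlogOf C K))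
    (hmajB : ∀ K, K₀ ≤ K → ∑ x ∈ X' K, q' K x ≤ V * r ^ (K - jlogOf C K))
    (hBB : ∀ K t, K₀ ≤ K → Bad' K t = Bad K t) :
    ∃ K₁, K₀ ≤ K₁ ∧ RelWeightBound l₀ (fun K => T (K₁ + K)) (fun K => A (K₁ + K)) (fun K => B (K₁ + K))
      (fun K => Bad (K₁ + K)) fun K => V * r ^ (K₁ + K - jlogOf C (K₁ + K)) := by
  obtain ⟨K₁, hK, hthr⟩ := exists_threshold_log h0 hr1 hV hC K₀
  exact ⟨K₁, hK, relWeightBound_of_extractionLaws_threshold_log hA hB hA0 hB0 h0 hr1 hV hC (fun K hK1 => hmajA K (hK.trans hK1))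
    (fun K hK1 => hmajB K (hK.trans hK1)) (fun K t hK1 => hBB K t (hK.trans hK1)) hthr⟩

end LogCut

end Summit.QuantumFields.YangMills.BalabanUVNodes.N20KnitLogCut

end
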